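import Summits.ValiantsHypothesis.ValiantsHypothesis.Theorems.LangWeilTransferTameResolutionFactorWeight

/-!
# LangWeilTransfer, support `TameResolution` (stmt-6378) / crux `TameTransfer` (stmt-6373) —
# the factor weight bound in the shape `ℤ[T₁..T_r][U]`

Route `LangWeilTransfer` of `ValiantsHypothesis`. The Kronecker-style construction of
`TameResolution` produces its eliminant as a polynomial `P ∈ R[U]` over `R = ℤ[T₁, …, T_r]`
(`Polynomial (MvPolynomial (Fin r) ℤ)`), and the hypersurface model `Q` as an irreducible factor of
it. This file restates the elementary factor weight bound `weight_le_of_dvd`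
(`LangWeilTransferTameResolutionFactorWeight`) in that shape:

* `degreeOf_finSuccEquiv_symm_le` — partial degrees of `(finSuccEquiv)⁻¹ P` from the `U`-degree of
  `P` and the partial degrees of its coefficients;
* `weight_finSuccEquiv_symm_le_of_dvd` — `G ∣ P ≠ 0` in `R[U]`, `deg_U P ≤ D`, all partial degrees
  of all coefficients `≤ D` ⇒ `wt G ≤ wt P · ((D+1)(2D+1)^{2D})^{r+1}`, weights read in
  `ℤ[X_0..X_r]` through `(finSuccEquiv ℤ r)⁻¹` (variable `0 = U`, `succ = T`, the route's convention);
* `sum_weight_coeff_le_of_dvd` — the same with the weights written as `Σ_k wt(coeff_k)`.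

Honest framing: helper `--supports` an open crux of a conditional route; VP ≠ VNP is NOT proved and
nothing here bears on it.
-/

noncomputable section

open MvPolynomial Polynomial
open scoped BigOperators

-- the summit and the problem share the name `ValiantsHypothesis` (D-0017 single-conjunct layout)
set_option linter.dupNamespace false

namespace Summit.ValiantsHypothesis.ValiantsHypothesis.Theorems.LangWeilTransfer

open Literature.Computability.AlgebraicComplexity

variable {r : ℕ}

/-- Partial degrees of `(finSuccEquiv ℤ r)⁻¹ P`: in the variable `0` it is `deg_U P`, in the
variable `succ j` it is bounded by the `X_j`-degrees of the coefficients of `P`. -/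
theorem degreeOf_finSuccEquiv_symm_le (P : Polynomial (MvPolynomial (Fin r) ℤ)) {D : ℕ}
    (hN : P.natDegree ≤ D) (hdeg : ∀ (k : ℕ) (j : Fin r), degreeOf j (P.coeff k) ≤ D) :
    ∀ i, degreeOf i ((finSuccEquiv ℤ r).symm P) ≤ D := by
  classical
  intro i
  refine Fin.cases ?_ (fun j => ?_) i
  · rw [← natDegree_finSuccEquiv, AlgEquiv.apply_symm_apply]
    exact hN
  · rw [degreeOf_le_iff]
    intro m hm
    have hm' : Finsupp.tail m ∈ ((finSuccEquiv ℤ r ((finSuccEquiv ℤ r).symm P)).coeff (m 0)).support := by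
      rw [mem_support_coeff_finSuccEquiv, Finsupp.cons_tail]
      exact hm
    rw [AlgEquiv.apply_symm_apply] at hm'
    have h := (degreeOf_le_iff.mp (hdeg (m 0) j)) (Finsupp.tail m) hm'
    rwa [Finsupp.tail_apply] at h

/-- **Factor weight bound in the shape `ℤ[T][U]`.** If `G ∣ P`, `P ≠ 0` in `ℤ[T₁..T_r][U]`,
`deg_U P ≤ D` and every coefficient of `P` has all partial degrees `≤ D`, then the weights read
in `ℤ[X_0..X_r]` satisfy `wt G ≤ wt P · ((D+1)(2D+1)^{2D})^{r+1}`. -/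
theorem weight_finSuccEquiv_symm_le_of_dvd (P G : Polynomial (MvPolynomial (Fin r) ℤ))
    (hP : P ≠ 0) (hGP : G ∣ P) {D : ℕ} (hN : P.natDegree ≤ D)
    (hdeg : ∀ (k : ℕ) (j : Fin r), degreeOf j (P.coeff k) ≤ D) :
    weight ((finSuccEquiv ℤ r).symm G) ≤
      weight ((finSuccEquiv ℤ r).symm P) * ((D + 1) * (2 * D + 1) ^ (2 * D)) ^ (r + 1) := by
  refine weight_le_of_dvd (r + 1) _ _ ?_ (map_dvd _ hGP) (degreeOf_finSuccEquiv_symm_le P hN hdeg)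
  exact fun h => hP ((finSuccEquiv ℤ r).symm.injective (by rw [h, map_zero]))

/-- The weight read through `(finSuccEquiv)⁻¹` is the sum of the weights of the coefficients. -/
theorem weight_finSuccEquiv_symm_eq_sum (P : Polynomial (MvPolynomial (Fin r) ℤ)) :
    weight ((finSuccEquiv ℤ r).symm P) = ∑ k ∈ P.support, weight (P.coeff k) := by
  rw [weight_eq_sum_weight_coeff, AlgEquiv.apply_symm_apply]

/-- **Factor weight bound, coefficient-sum form**: under the same hypotheses,
`Σ_k wt(coeff_k G) ≤ (Σ_k wt(coeff_k P)) · ((D+1)(2D+1)^{2D})^{r+1}`. -/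
theorem sum_weight_coeff_le_of_dvd (P G : Polynomial (MvPolynomial (Fin r) ℤ))
    (hP : P ≠ 0) (hGP : G ∣ P) {D : ℕ} (hN : P.natDegree ≤ D)
    (hdeg : ∀ (k : ℕ) (j : Fin r), degreeOf j (P.coeff k) ≤ D) :
    ∑ k ∈ G.support, weight (G.coeff k) ≤
      (∑ k ∈ P.support, weight (P.coeff k)) * ((D + 1) * (2 * D + 1) ^ (2 * D)) ^ (r + 1) := by
  rw [← weight_finSuccEquiv_symm_eq_sum, ← weight_finSuccEquiv_symm_eq_sum]
  exact weight_finSuccEquiv_symm_le_of_dvd P G hP hGP hN hdeg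

/-- Every single coefficient of a factor is bounded by the same quantity. -/
theorem weight_coeff_le_of_dvd (P G : Polynomial (MvPolynomial (Fin r) ℤ))
    (hP : P ≠ 0) (hGP : G ∣ P) {D : ℕ} (hN : P.natDegree ≤ D)
    (hdeg : ∀ (k : ℕ) (j : Fin r), degreeOf j (P.coeff k) ≤ D) (k : ℕ) :
    weight (G.coeff k) ≤
      (∑ k ∈ P.support, weight (P.coeff k)) * ((D + 1) * (2 * D + 1) ^ (2 * D)) ^ (r + 1) := by
  classical
  refine le_trans ?_ (sum_weight_coeff_le_of_dvd P G hP hGP hN hdeg)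
  by_cases hk : k ∈ G.support
  · exact Finset.single_le_sum (f := fun k => weight (G.coeff k)) (fun _ _ => Nat.zero_le _) hk
  · rw [Polynomial.notMem_support_iff.mp hk, weight_zero]
    exact Nat.zero_le _

end Summit.ValiantsHypothesis.ValiantsHypothesis.Theorems.LangWeilTransfer

end
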